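import Summits.AtomisticToContinuum.FouriersLaw.Theses.BondHeatUncertainty
import Literature.MathematicalPhysics.KineticTheory.LangevinChainReversal
import Literature.Probability.Entropy.FluctuationTheoremUncertainty

/-!
# Line `lebesgue-flip-duality` for crux `LinearResponseFTUR` (★, stmt-AtomisticToContinuum-9122)

Skeleton (crux-plan, round 1) of the line "reverse LEBESGUE, not the NESS": the generalised
detailed balance of the thermostatted chain started from Lebesgue measure,

  (GDB)  `Θ̃_* R = exp(Q_L/T_L + Q_R/T_R) · R`,  `R = ∫ dz P_z` (σ-finite path measure),

obtained from (K1) the path-level Lebesgue duality `r_* R = e^{2γt} R̂` (time reversal `r`; `R̂` the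
reversed-drift chain from Lebesgue — the path extension of the tree's two-time kernel duality
`OscillatorChain.IsConfining.lintegral_langevinKernel_duality`) and (K3) ONE Girsanov formula for the
LINEAR drift change `2γ 1_B p` (damped ↔ anti-damped chain, the anti-damped chain being the
`Θ`-conjugate of the reversed-drift chain), whose density is PATHWISE `e^{-2γt} exp(Σ_b Q_b/T_b)`.
Multiplying (GDB) by the NESS density at time `0` gives the Lebowitz–Spohn formula
`Σ_t = log ρ_δ(x_0) - log ρ_δ(Θ x_t) - Q_L/T_L - Q_R/T_R` EXACTLY (K4), hence
`⟨Σ_t⟩ = KL(μ_δ ‖ Θ_*μ_δ) + t J_δ (1/T_R - 1/T_L)` (K4 + heat rates), and the vendored, PROVED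
Hasegawa–Van Vu inequality `Literature.Probability.Entropy.HasegawaVanVu2019_FTUR` plus the `δ → 0`
bookkeeping (proved below, = Disproof §7) give conclusion (b); conclusion (a) is the finite-bias
Clausius inequality.

## Path space, finite-dimensionally
Everything is typed on the FINITE-DIMENSIONAL observable space
`Obs N = PhaseSpace N × PhaseSpace N × ℝ × ℝ × ℝ` with RAW coordinates `(x_0, x_t, I_L, I_R, Q^b)`:
endpoints, the two work integrals `I_i = ∫₀ᵗ p_i ∂_{q_i}H ds` of the thermostatted momenta
(`i = 0, N-1`) and the bond heat `Q^b = ∫₀ᵗ j_b ds` (the "counting field"). The bath heats are the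
functions `Q_i = p_i(t)²/2 - p_i(0)²/2 + I_i` on `Obs N` (`leftHeat`, `rightHeat`; no stochastic
integral anywhere). Time reversal ∘ momentum flip `Θ̃` acts on `Obs N` as the involution
`flipObs (x, y, u, v, e) = (Θ y, Θ x, -u, -v, -e)` and pure time reversal as `swapObs`. Since
`Σ_t` is a function of `(x_0, x_t, Q_L, Q_R)`, passing to this marginal loses nothing (no
data-processing slack; constant `2` kept — `not_shape_two_add`).

## Vocabulary
Explicit ABBREVIATIONS only (`Obs`, `swapObs`, `flipObs`, `leftHeat`, `rightHeat`, `workIntegral`,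
`bondHeat`, `rawObs`, `fwdPath`, `revPath`, `fluxLaw`, `eqCurrentAutocorr`, `bondHeatVariance`);
nothing is posited, no structure carries axioms. The SAME vocabulary, byte-identical, is proposed as the
route's definitions file `Theorems/BondHeatUncertaintyDefs.lean` (namespace
`Summit.AtomisticToContinuum.FouriersLaw.Theorems.BondHeatUncertainty`); stub files import it, so the
registered signatures below are exactly the signatures landed.

## Registered stubs (7, lead reshape 2026-08-16) and the composition
* `stub_pathLebesgueDuality`        (K1, M)   — `PathLebesgueDuality`
* `stub_antiDampedGirsanov`         (K3, L, HARDEST, held by the lead) — `AntiDampedGirsanov`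
* `stub_entropyBalance`             (K4, L)   — `HeatFluxDetailedBalance → StationaryEntropyBalance`
* `stub_steadyHeatRates`            (M)       — `SteadyHeatRates` (now also `⟨p_0 ∂_{q_0}H⟩_μ = J`)
* `stub_equilibriumBondHeatVariance` (K6a, M/L) — `EquilibriumBondHeatVariance` (`Var_T(Q_t) = V_N(b,t)`)
* `stub_bondHeatVarianceContinuity` (K6b, L)  — `BondHeatVarianceContinuity` (`Var_δ(Q_t) → Var_T(Q_t)`)
* `stub_finiteBiasClausius`         (M/L)     — `HeatFluxDetailedBalance → FiniteBiasClausius`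
  (injected-power form `0 ≤ (T_L - T_R)⟨p_0 ∂_{q_0}H⟩_μ`, via the transient fluctuation theorem from the
  Gibbs(`T_R`) start + Cesàro ergodicity + uniqueness; no NESS density)
Reshape rationale: the old standalone `FiniteBiasClausius` silently needed (GDB) (or a Fisher sum rule with
NESS density regularity) — it is now an implication from `HeatFluxDetailedBalance` like K4; the old K6 is cut
into the equilibrium identity (K6a, partly landed by the sibling crux 9120: `…BathBondReductionTwoTime`,
`…FlowLaws`) and the δ-continuity (K6b); `stub_finiteEntropy`-type inputs are NOT needed anywhere (K4's
coboundary term is handled by stationarity + truncation + Fatou, see its docstring).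
PROVED here (no `sorry`): `heatFluxDetailedBalance_of : PathLebesgueDuality → AntiDampedGirsanov →
HeatFluxDetailedBalance` (the lever composes AS TYPED), the `δ → 0` certificate
`shape_of_hvv_family` (verbatim logic of Disproof §7 `fturShape_pointwise_of_hvv_family`), the
transfer `transfer : TransferStatement` (C⁺ ⇒ ★ given K4, rates, K6a, K6b, Clausius) and the composition
`lineComposition : LineComposition` (= the seven stub statements → `LinearResponseFTUR`); finally
`LinearResponseFTUR_of : LinearResponseFTUR` (the crux BY NAME) = `lineComposition` applied to the seven
`stub_*` theorems — the only declarations containing `sorry`.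

## Disproof.lean (cycle 2) honoured
`fturShape_false_without_K`: the `K`-term enters at `stub_entropyBalance` as the endpoint density
ratio `log ρ_δ(x_0) - log ρ_δ(Θx_t)`, whose mean is `KL(μ_δ‖Θ_*μ_δ)`; `not_fturShape_two_add` /
`fturShape_memory_le`: identity-level line, HVV applied at each `δ` with the exact `⟨Σ_t⟩`, constants
certified by `shape_of_hvv_family`; `fturShape_eq_zero_of_nonpos`: `stub_bondHeatVarianceLimit`
must identify the honest variance limit with the crux's `V` (interval-integrability of `C_N(b,·)`);
§8 `klDiv_momentumFlip_comm`: direction immaterial; landed Negative lemmas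
(`Theorems/LinearResponseFTUR/Negative/{KZeroCorner,ShapeConstraints}`): no stub is an instance they
refute (no stub has the `FTURShape` form; `K = 0` forces `D = 0` consistently via `StationaryEntropyBalance`).
-/

noncomputable section

namespace Summit.AtomisticToContinuum.FouriersLaw.Cruxes.LinearResponseFTUR.LebesgueFlipDuality

open MeasureTheory ProbabilityTheory Filter Topology
open scoped NNReal ENNReal
open Literature.MathematicalPhysics.KineticTheory
open Literature.MathematicalPhysics.KineticTheory.HeatConduction
open Literature.Probability.Process
open Summit.AtomisticToContinuum.FouriersLaw.Theses.BondHeatUncertainty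

/-! ## Vocabulary (explicit abbreviations) -/

/-- The observable space `(x_0, x_t, I_L, I_R, Q^b)`: endpoints of a path on `[0, t]`, the two work
integrals of the thermostatted momenta and the heat through one bond. -/
abbrev Obs (N : ℕ) : Type := PhaseSpace N × PhaseSpace N × ℝ × ℝ × ℝ

/-- Pure time reversal on `Obs N`: endpoints swap, the three integrals are invariant. -/
def swapObs (N : ℕ) (p : Obs N) : Obs N := (p.2.1, p.1, p.2.2)

/-- Time reversal ∘ momentum flip `Θ̃` on `Obs N`: `(x, y, u, v, e) ↦ (Θ y, Θ x, -u, -v, -e)`. -/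
def flipObs (N : ℕ) (p : Obs N) : Obs N :=
  ((p.2.1.1, -p.2.1.2), (p.1.1, -p.1.2), -p.2.2.1, -p.2.2.2.1, -p.2.2.2.2)

/-- Heat absorbed from the bath at site `i0` read off `Obs N`: `p_{i0}(t)²/2 - p_{i0}(0)²/2 + I_L`. -/
def leftHeat {N : ℕ} (i0 : Fin N) (p : Obs N) : ℝ :=
  p.2.1.2 i0 ^ 2 / 2 - p.1.2 i0 ^ 2 / 2 + p.2.2.1

/-- Heat absorbed from the bath at site `iN` read off `Obs N`: `p_{iN}(t)²/2 - p_{iN}(0)²/2 + I_R`. -/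
def rightHeat {N : ℕ} (iN : Fin N) (p : Obs N) : ℝ :=
  p.2.1.2 iN ^ 2 / 2 - p.1.2 iN ^ 2 / 2 + p.2.2.2.1

/-- Work integral of the momentum at site `i` against the Hamiltonian force along a path `X`:
`I_i(X) = ∫₀ᵗ p_i(s) ∂_{q_i}H(X(s)) ds` (so that the heat from a bath at `i` is `Δ(p_i²/2) + I_i`,
no stochastic integral). -/
def workIntegral (P : OscillatorChain) (N : ℕ) (i : Fin N) (t : ℝ) (X : ℝ → PhaseSpace N) : ℝ :=
  ∫ s in (0 : ℝ)..t, (X s).2 i * partialQ i (P.hamiltonian N) (X s)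

/-- Heat through bond `(i, i+1)` along a path: `Q^{(i)}(X) = ∫₀ᵗ j_i(X(s)) ds`. -/
def bondHeat (P : OscillatorChain) (N : ℕ) (i : Fin N) (t : ℝ) (X : ℝ → PhaseSpace N) : ℝ :=
  ∫ s in (0 : ℝ)..t, P.bondCurrent N i (X s)

/-- The raw observable of a path `X` started at `z`: `(z, X t, I_{i0}, I_{iN}, Q^{(ib)})`. -/
def rawObs (P : OscillatorChain) (N : ℕ) (i0 iN ib : Fin N) (t : ℝ) (z : PhaseSpace N)
    (X : ℝ → PhaseSpace N) : Obs N :=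
  (z, X t, workIntegral P N i0 t X, workIntegral P N iN t X, bondHeat P N ib t X)

/-- The forward (damped) path from `z` driven by the Brownian pair of the raw sample `w`
(`OscillatorChain.solMap`, the flow behind `OscillatorChain.transitionKernel`). -/
def fwdPath (P : OscillatorChain) (N : ℕ) (T_L T_R : ℝ) (z : PhaseSpace N) (w : WienerPair) :
    ℝ → PhaseSpace N :=
  fun s => P.solMap N T_L T_R s z (pairPath w)

/-- The reversed-drift path from `y`: the flow of `dz = -Y(z) dt + v_L dB^L + v_R dB^R` (the flow
behind `OscillatorChain.langevinRevKernel`; its `Θ`-conjugate is the ANTI-damped chain). -/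
def revPath (P : OscillatorChain) (N : ℕ) (T_L T_R : ℝ) (y : PhaseSpace N) (w : WienerPair) :
    ℝ → PhaseSpace N :=
  fun s => sdeSolMap (fun x => -P.drift N x) (P.bathVecL N T_L) (P.bathVecR N T_R) s y (pairPath w)

/-- The law on `Obs N` of the raw observable of the forward process on `[0, t]` started from `μ`
(for the NESS `μ_δ`: the endpoint–heat marginal of the stationary path measure `P_δ`). -/
def fluxLaw (P : OscillatorChain) (N : ℕ) (i0 iN ib : Fin N) (T_L T_R t : ℝ)
    (μ : Measure (PhaseSpace N)) : Measure (Obs N) :=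
  (μ.prod wienerPair).map fun zw => rawObs P N i0 iN ib t zw.1 (fwdPath P N T_L T_R zw.1 zw.2)

/-- The equilibrium current autocorrelation `C_N(b,s)` of the crux (verbatim). -/
def eqCurrentAutocorr (ω₂ lam β γ T : ℝ) (N b : ℕ) (s : ℝ) : ℝ :=
  if h : b < N then
    ∫ z, (pinnedChain ω₂ lam β γ).bondCurrent N ⟨b, h⟩ z *
        (∫ y, (pinnedChain ω₂ lam β γ).bondCurrent N ⟨b, h⟩ y
          ∂((pinnedChain ω₂ lam β γ).transitionKernel N T T s.toNNReal z))
      ∂((pinnedChain ω₂ lam β γ).gibbsMeasure N T)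
  else 0

/-- The equilibrium bond-heat variance `V_N(b,t) = 2∫₀ᵗ (t-s) C_N(b,s) ds` of the crux (verbatim). -/
def bondHeatVariance (ω₂ lam β γ T : ℝ) (N b : ℕ) (t : ℝ) : ℝ :=
  2 * ∫ s in (0 : ℝ)..t, (t - s) * eqCurrentAutocorr ω₂ lam β γ T N b s

/-! ### Elementary facts about the vocabulary -/

theorem swapObs_swapObs (N : ℕ) (p : Obs N) : swapObs N (swapObs N p) = p := rfl

theorem flipObs_swapObs (N : ℕ) (p : Obs N) : flipObs N (swapObs N p) = swapObs N (flipObs N p) :=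
  rfl

theorem flipObs_involutive (N : ℕ) : Function.Involutive (flipObs N) := by
  rintro ⟨x, y, u, v, e⟩
  simp [flipObs]

theorem measurable_swapObs (N : ℕ) : Measurable (swapObs N) := by
  unfold swapObs
  fun_prop

theorem measurable_flipObs (N : ℕ) : Measurable (flipObs N) := by
  unfold flipObs
  fun_prop

/-- The bond heat is exactly odd under `Θ̃`. -/
theorem bondCoord_flipObs (N : ℕ) (p : Obs N) : (flipObs N p).2.2.2.2 = -p.2.2.2.2 := rfl

/-- The bath heats are exactly odd under `Θ̃`. -/
theorem leftHeat_flipObs {N : ℕ} (i0 : Fin N) (p : Obs N) :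
    leftHeat i0 (flipObs N p) = -leftHeat i0 p := by
  simp only [leftHeat, flipObs, Pi.neg_apply]
  ring

/-! ## The stub statements

Statement texts are `let`-free (the ledger registers the text of each `stub_*` signature): the chain
is written `pinnedChain ω₂ lam β γ` at every occurrence, the bath sites and the bond are universally
quantified indices `i0 iN ib : Fin N` pinned by `i0.val = 0`, `iN.val = N - 1` (and `ib.val + 1 < N`
where a real bond is needed), and the flux law is spelled `fluxLaw (pinnedChain ω₂ lam β γ) N i0 iN ib …`. -/

/-- **K1 — path-level Lebesgue duality (endpoint–work–bond-heat marginal).** For the pinned chain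
(`N ≥ 2`, `t > 0`): `r_* R = e^{2γt} R̂` on the observables `(x_0, x_t, I_L, I_R, Q^b)` — under pure
time reversal the endpoints swap and the three integrals are invariant; `R = ∫dz P_z` the damped
chain from Lebesgue, `R̂ = ∫dy P̂_y` the reversed-drift chain from Lebesgue. The two-time case
(`G` depending on the endpoints only) is the tree's
`OscillatorChain.IsConfining.lintegral_langevinKernel_duality` (with `pinnedChain_isConfining` and
`pinnedChain_langevinSolMap_eq_solMap` of `Theorems/BondHeatUncertaintySubdiffusiveBondHeatKernelGibbsA`);
the extension to the path functionals is the PATHWISE bijection `x ↦ Φ_t(x, B)` (Jacobian `e^{-2γt}`,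
inverse = reversed flow driven by the reversed pair, which retraces the forward path:
`ConfinedFlowReversal.flow_reverse_eqOn`, `ConfinedFlowJacobian.lintegral_comp_flow_mul`,
`ConfinedDuality.sdeSolMap_pairRev_eq`, `BrownianPairReversal.map_pairRev_wienerPair`), so that the
three `ds`-integrals of state functions along the path are unchanged. -/
def PathLebesgueDuality : Prop :=
  ∀ ω₂ lam β γ : ℝ, 0 < ω₂ → 0 < lam → 0 < β → 0 < γ →
  ∀ (N : ℕ) (i0 iN ib : Fin N), 2 ≤ N → i0.val = 0 → iN.val = N - 1 →
  ∀ (T_L T_R : ℝ), 0 < T_L → 0 < T_R → ∀ t : ℝ, 0 < t →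
  ∀ G : Obs N → ℝ≥0∞, Measurable G →
    ∫⁻ z, ∫⁻ w, G (swapObs N (rawObs (pinnedChain ω₂ lam β γ) N i0 iN ib t z
        (fwdPath (pinnedChain ω₂ lam β γ) N T_L T_R z w))) ∂wienerPair =
      ENNReal.ofReal (Real.exp (2 * γ * t)) *
        ∫⁻ y, ∫⁻ w, G (rawObs (pinnedChain ω₂ lam β γ) N i0 iN ib t y
          (revPath (pinnedChain ω₂ lam β γ) N T_L T_R y w)) ∂wienerPair

/-- **K3 — the anti-damped Girsanov formula (HARDEST stub).** For `N ≥ 2`, `t ≥ 0`, every `y` and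
every measurable `F ≥ 0` on `Obs N`:
`e^{2γt} E[F(y, Θ X̂_t, -Î_L, -Î_R, -Q̂^b)] = E_y[exp(Q_L/T_L + Q_R/T_R) F(y, X_t, I_L, I_R, Q^b)]`,
where `X̂` is the reversed-drift path started at `Θ y` (so `Θ ∘ X̂` is the ANTI-damped chain from
`y` driven by the flipped pair: friction `+γ p_b`, same Hamiltonian part; `I_i(Θ∘X̂) = -I_i(X̂)`,
`Q^b(Θ∘X̂) = -Q^b(X̂)` since `∂_{q_i}H` is even and `j_b` odd in the momenta) and `X` the damped path
from `y`. Content: `dP^{anti}_y/dP_y |_{F_t} = ℰ(Σ_b ∫ √(2γ/T_b) p_b dW_b)_t = e^{-2γt} exp(Σ_b Q_b/T_b)`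
PATHWISE by the Itô energy identity at each bath site (`Q_b = Δ(p_b²/2) + I_b`, Itô term `γT_b dt`
inside `Δ(p_b²/2)`), a measurable function OF the observable. Lead's route (no general Girsanov):
exact discrete Cameron–Martin for predictable triangular shifts of the Gaussian increment vector on a
damped / anti-damped splitting scheme driven by the dyadic skeleton of the pair, pathwise convergence
of both schemes (flow Lipschitz in the noise path), and the two-sided Fatou sandwich
`Z·P ≤ P^a`, `Z⁻¹·P^a ≤ P`, `Z⁻¹Z = 1` pathwise ⇒ `P^a = Z·P` (no true-martingale / non-explosion
input at the critical exponent). -/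
def AntiDampedGirsanov : Prop :=
  ∀ ω₂ lam β γ : ℝ, 0 < ω₂ → 0 < lam → 0 < β → 0 < γ →
  ∀ (N : ℕ) (i0 iN ib : Fin N), 2 ≤ N → i0.val = 0 → iN.val = N - 1 →
  ∀ (T_L T_R : ℝ), 0 < T_L → 0 < T_R → ∀ t : ℝ, 0 ≤ t →
  ∀ (y : PhaseSpace N) (F : Obs N → ℝ≥0∞), Measurable F →
    ENNReal.ofReal (Real.exp (2 * γ * t)) *
        ∫⁻ w, F (swapObs N (flipObs N (rawObs (pinnedChain ω₂ lam β γ) N i0 iN ib t (y.1, -y.2)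
          (revPath (pinnedChain ω₂ lam β γ) N T_L T_R (y.1, -y.2) w)))) ∂wienerPair =
      ∫⁻ w, ENNReal.ofReal (Real.exp
          (leftHeat i0 (rawObs (pinnedChain ω₂ lam β γ) N i0 iN ib t y
              (fwdPath (pinnedChain ω₂ lam β γ) N T_L T_R y w)) / T_L +
            rightHeat iN (rawObs (pinnedChain ω₂ lam β γ) N i0 iN ib t y
              (fwdPath (pinnedChain ω₂ lam β γ) N T_L T_R y w)) / T_R)) *
        F (rawObs (pinnedChain ω₂ lam β γ) N i0 iN ib t y
          (fwdPath (pinnedChain ω₂ lam β γ) N T_L T_R y w)) ∂wienerPair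

/-- **C⁺ — the heat-flux detailed balance (GDB on the endpoint–heat marginal).** For `N ≥ 2`,
`t > 0` and measurable `F ≥ 0` on `Obs N`:
`∫dz E_z[F(Θ̃ · obs)] = ∫dz E_z[exp(Q_L/T_L + Q_R/T_R) F(obs)]`, i.e. `Θ̃_* R = e^{Σ_b Q_b/T_b} · R`
on `σ(x_0, x_t, I_L, I_R, Q^b)`. DERIVED below from K1 + K3 (`heatFluxDetailedBalance_of`). At
`T_L = T_R = T` and against the Gibbs density it is `Θ`-detailed balance of the equal-temperature
kernel w.r.t. Gibbs (the input every line of this crux shares). It is the HYPOTHESIS of the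
registered stubs `stub_entropyBalance` and `stub_finiteBiasClausius`. -/
def HeatFluxDetailedBalance : Prop :=
  ∀ ω₂ lam β γ : ℝ, 0 < ω₂ → 0 < lam → 0 < β → 0 < γ →
  ∀ (N : ℕ) (i0 iN ib : Fin N), 2 ≤ N → i0.val = 0 → iN.val = N - 1 →
  ∀ (T_L T_R : ℝ), 0 < T_L → 0 < T_R → ∀ t : ℝ, 0 < t →
  ∀ F : Obs N → ℝ≥0∞, Measurable F →
    ∫⁻ z, ∫⁻ w, F (flipObs N (rawObs (pinnedChain ω₂ lam β γ) N i0 iN ib t z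
        (fwdPath (pinnedChain ω₂ lam β γ) N T_L T_R z w))) ∂wienerPair =
      ∫⁻ z, ∫⁻ w, ENNReal.ofReal (Real.exp
          (leftHeat i0 (rawObs (pinnedChain ω₂ lam β γ) N i0 iN ib t z
              (fwdPath (pinnedChain ω₂ lam β γ) N T_L T_R z w)) / T_L +
            rightHeat iN (rawObs (pinnedChain ω₂ lam β γ) N i0 iN ib t z
              (fwdPath (pinnedChain ω₂ lam β γ) N T_L T_R z w)) / T_R)) *
        F (rawObs (pinnedChain ω₂ lam β γ) N i0 iN ib t z
          (fwdPath (pinnedChain ω₂ lam β γ) N T_L T_R z w)) ∂wienerPair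

/-- **K4 (conclusion) — the stationary entropy balance, Lebowitz–Spohn form.** Under weak-NESS
uniqueness, for every weak steady state `μ` of the `N`-site chain (`N ≥ 2`) at `T_L, T_R > 0` whose
snapshot irreversibility `KL(μ ‖ Θ_*μ)` is finite, the endpoint–heat law `P = fluxLaw … μ` of the
stationary process on `[0, t]` and its `Θ̃`-image are mutually absolutely continuous with integrable
log-likelihood ratio, the two bath heats are integrable, and
`∫ log(dP/dΘ̃_*P) dP = KL(μ ‖ Θ_*μ) - E[Q_L]/T_L - E[Q_R]/T_R`.
Proof from (GDB) (the registered stub is the implication `HeatFluxDetailedBalance → …`): uniqueness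
identifies `μ` with the Krylov–Bogoliubov state of the constructed kernels (probability, kernel-INVARIANT,
`μ ≪ Leb` with density `ρ`, `e^{ϑH} ∈ L¹`: `Theorems/…LinearResponseFTURNessFacts.ness_facts`);
`P = ρ(x_0)·R_obs` and, by (GDB), `Θ̃_*P = ρ(Θx_t)e^{W}·R_obs`, `W = Q_L/T_L + Q_R/T_R`, `R_obs` the
(σ-finite) image of `Leb ⊗ Wiener`; so `P ≪ Θ̃_*P ⟺ P(ρ(Θx_t) = 0) = 0 ⟺ μ(ρ∘Θ = 0) = 0` (law of
`x_t` is `μ` by invariance) `⟺ μ ≪ Θ_*μ`, which `KL(μ‖Θ_*μ) ≠ ⊤` gives; the reverse direction is the same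
condition (`Θ̃` is an involution); `llr = [log ρ(x_0) - log ρ(Θx_0)] + D - W` with
`D := f(x_0) - f(x_t)`, `f := log ρ∘Θ` (finite `μ`-a.e.); the first bracket is `llr(μ, Θ_*μ)(x_0)`,
integrable with mean `KL(μ‖Θ_*μ)` (Mathlib `klDiv_ne_top_iff`), `W` is integrable (moments); NO finite
entropy of `ρ` is needed for `D`: `llr⁻ ∈ L¹(P)` always (`x log x ≥ -1/e`, `Θ̃_*P` finite), hence
`D⁻ ∈ L¹`; with the truncations `f_n = max(min(f,n),-n)` one has `E[f_n(x_0) - f_n(x_t)] = 0`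
(invariance), `|f_n(x_0) - f_n(x_t)| ≤ |D|`, `(f_n(x_0) - f_n(x_t))⁻ ≤ D⁻`, so Fatou gives
`E D⁺ ≤ liminf E(f_n(x_0)-f_n(x_t))⁺ = liminf E(f_n(x_0)-f_n(x_t))⁻ ≤ E D⁻ < ∞`, and then dominated
convergence gives `E D = 0`. This is where the crux's `K` enters (`fturShape_false_without_K`). -/
def StationaryEntropyBalance : Prop :=
  ∀ ω₂ lam β γ : ℝ, 0 < ω₂ → 0 < lam → 0 < β → 0 < γ →
  (∀ (N : ℕ) (T_L T_R : ℝ), 0 < T_L → 0 < T_R → ∀ μ ν : Measure (PhaseSpace N),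
    (pinnedChain ω₂ lam β γ).IsSteadyState N T_L T_R μ →
    (pinnedChain ω₂ lam β γ).IsSteadyState N T_L T_R ν → μ = ν) →
  ∀ (N : ℕ) (i0 iN ib : Fin N), 2 ≤ N → i0.val = 0 → iN.val = N - 1 →
  ∀ (T_L T_R : ℝ), 0 < T_L → 0 < T_R → ∀ μ : Measure (PhaseSpace N),
    (pinnedChain ω₂ lam β γ).IsSteadyState N T_L T_R μ →
    InformationTheory.klDiv μ (Measure.map (fun x : PhaseSpace N => (x.1, -x.2)) μ) ≠ ⊤ →
  ∀ t : ℝ, 0 < t →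
    IsProbabilityMeasure (fluxLaw (pinnedChain ω₂ lam β γ) N i0 iN ib T_L T_R t μ) ∧
    fluxLaw (pinnedChain ω₂ lam β γ) N i0 iN ib T_L T_R t μ ≪
      (fluxLaw (pinnedChain ω₂ lam β γ) N i0 iN ib T_L T_R t μ).map (flipObs N) ∧
    (fluxLaw (pinnedChain ω₂ lam β γ) N i0 iN ib T_L T_R t μ).map (flipObs N) ≪
      fluxLaw (pinnedChain ω₂ lam β γ) N i0 iN ib T_L T_R t μ ∧
    Integrable (llr (fluxLaw (pinnedChain ω₂ lam β γ) N i0 iN ib T_L T_R t μ)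
      ((fluxLaw (pinnedChain ω₂ lam β γ) N i0 iN ib T_L T_R t μ).map (flipObs N)))
      (fluxLaw (pinnedChain ω₂ lam β γ) N i0 iN ib T_L T_R t μ) ∧
    Integrable (leftHeat i0) (fluxLaw (pinnedChain ω₂ lam β γ) N i0 iN ib T_L T_R t μ) ∧
    Integrable (rightHeat iN) (fluxLaw (pinnedChain ω₂ lam β γ) N i0 iN ib T_L T_R t μ) ∧
    ∫ p, llr (fluxLaw (pinnedChain ω₂ lam β γ) N i0 iN ib T_L T_R t μ)
        ((fluxLaw (pinnedChain ω₂ lam β γ) N i0 iN ib T_L T_R t μ).map (flipObs N)) p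
        ∂(fluxLaw (pinnedChain ω₂ lam β γ) N i0 iN ib T_L T_R t μ) =
      (InformationTheory.klDiv μ (Measure.map (fun x : PhaseSpace N => (x.1, -x.2)) μ)).toReal -
        (∫ p, leftHeat i0 p ∂(fluxLaw (pinnedChain ω₂ lam β γ) N i0 iN ib T_L T_R t μ)) / T_L -
        (∫ p, rightHeat iN p ∂(fluxLaw (pinnedChain ω₂ lam β γ) N i0 iN ib T_L T_R t μ)) / T_R

/-- **Steady heat rates** (stationarity + energy balance at finite bias): under weak-NESS
uniqueness, in the weak steady state `μ` of the `N`-site chain (`N ≥ 2`) the mean heat absorbed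
from the left bath on `[0, t]`, minus the mean heat absorbed from the right bath, and the mean heat
through EVERY real bond `(b, b+1)` all equal `t · J`, `J = totalCurrent(μ)/(N-1)`; and (fourth
conjunct, lead reshape) the mean work rate of the left thermostatted momentum against the force,
`⟨p_0 ∂_{q_0}H⟩_μ`, equals `J` — the injected-power form in which `FiniteBiasClausius` is concluded.
Proof: `μ` is the kernel-invariant Krylov–Bogoliubov state (`ness_facts`), so the law of `x_s` under
`μ ⊗ W` is `μ` for every `s` (`…FlowLaws.pinnedChain_map_solMap_of_invariant`), `E[Δ(p_i²/2)] = 0` and,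
by Fubini, `E[I_i] = t·μ(p_i ∂_{q_i}H)`, `E[Q^b] = t·μ(j_b)`; weak stationarity tested (with the energy
cut-off `χ(H/R)`, `R → ∞`, dominated convergence from the polynomial bounds × `e^{ϑH} ∈ L¹`) on
`p_0²/2` gives `μ(p_0∂_{q_0}H) = γ(T_L - μ(p_0²))`, on the block energies
`e_b = Σ_{i≤b}(p_i²/2 + U(q_i)) + Σ_{i<b}V + ½V(q_{b+1}-q_b)` (`L e_b = -j_b + γ(T_L - p_0²)`,
`…BathBondReductionGenerator.pinnedChain_generator_siteEnergy` for `b = 0`) gives `μ(j_b) = γ(T_L - μ(p_0²))`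
for every real bond, hence all equal `J`; symmetrically on the right (`bondCurrent N ⟨N-1,_⟩ = 0`). -/
def SteadyHeatRates : Prop :=
  ∀ ω₂ lam β γ : ℝ, 0 < ω₂ → 0 < lam → 0 < β → 0 < γ →
  (∀ (N : ℕ) (T_L T_R : ℝ), 0 < T_L → 0 < T_R → ∀ μ ν : Measure (PhaseSpace N),
    (pinnedChain ω₂ lam β γ).IsSteadyState N T_L T_R μ →
    (pinnedChain ω₂ lam β γ).IsSteadyState N T_L T_R ν → μ = ν) →
  ∀ (N : ℕ) (i0 iN ib : Fin N), 2 ≤ N → i0.val = 0 → iN.val = N - 1 → ib.val + 1 < N →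
  ∀ (T_L T_R : ℝ), 0 < T_L → 0 < T_R → ∀ μ : Measure (PhaseSpace N),
    (pinnedChain ω₂ lam β γ).IsSteadyState N T_L T_R μ →
  ∀ t : ℝ, 0 ≤ t →
    ∫ p, leftHeat i0 p ∂(fluxLaw (pinnedChain ω₂ lam β γ) N i0 iN ib T_L T_R t μ) =
      t * ((pinnedChain ω₂ lam β γ).totalCurrent μ / ((N : ℝ) - 1)) ∧
    ∫ p, rightHeat iN p ∂(fluxLaw (pinnedChain ω₂ lam β γ) N i0 iN ib T_L T_R t μ) =
      -(t * ((pinnedChain ω₂ lam β γ).totalCurrent μ / ((N : ℝ) - 1))) ∧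
    ∫ p, p.2.2.2.2 ∂(fluxLaw (pinnedChain ω₂ lam β γ) N i0 iN ib T_L T_R t μ) =
      t * ((pinnedChain ω₂ lam β γ).totalCurrent μ / ((N : ℝ) - 1)) ∧
    ∫ x, x.2 i0 * partialQ i0 ((pinnedChain ω₂ lam β γ).hamiltonian N) x ∂μ =
      (pinnedChain ω₂ lam β γ).totalCurrent μ / ((N : ℝ) - 1)

/-- **K6a — the equilibrium bond-heat variance is the crux's `V_N(b,t)`.** Under weak-NESS uniqueness,
along a steady-state family, at EQUAL temperatures `T_L = T_R = T` (where the member `μ N T T` is the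
Gibbs measure `gibbsMeasure N T` by `pinnedChain_isSteadyState_gibbsMeasure` + (U), hence invariant under
the constructed kernels — the Krylov–Bogoliubov measure is a weak steady state, `ness_facts`), for
`N ≥ 2`, a real bond `ib` and `t > 0`: the bond heat `Q_t = ∫₀ᵗ j_b(z_s) ds` along the stationary flow
is square integrable and `Var_T(Q_t) = V_N(b,t) = 2∫₀ᵗ(t-s)C_N(b,s)ds` (mean `t·μ_T(j_b) = 0`,
`pinnedChain_integral_bondCurrent_gibbsMeasure`; second moment by the two-time law of the flow from an
invariant law `…BathBondReductionTwoTime.pinnedChain_integral_solMap_pair_of_invariant`, Fubini, the lag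
identities `…FlowLaws.integral_integral_triangle_eq` / `setIntegral_square_lag_eq`; `s ↦ C_N(b,s)`
measurable and bounded on `[0,t]` by Cauchy–Schwarz + invariance — this is where the crux's iterated
Bochner / interval integrals are shown NOT to be junk, `fturShape_eq_zero_of_nonpos`). -/
def EquilibriumBondHeatVariance : Prop :=
  ∀ ω₂ lam β γ : ℝ, 0 < ω₂ → 0 < lam → 0 < β → 0 < γ →
  (∀ (N : ℕ) (T_L T_R : ℝ), 0 < T_L → 0 < T_R → ∀ μ ν : Measure (PhaseSpace N),
    (pinnedChain ω₂ lam β γ).IsSteadyState N T_L T_R μ →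
    (pinnedChain ω₂ lam β γ).IsSteadyState N T_L T_R ν → μ = ν) →
  ∀ μ : (N : ℕ) → ℝ → ℝ → Measure (PhaseSpace N),
    (∀ (N : ℕ) (T_L T_R : ℝ), 0 < T_L → 0 < T_R →
      (pinnedChain ω₂ lam β γ).IsSteadyState N T_L T_R (μ N T_L T_R)) →
  ∀ T : ℝ, 0 < T → ∀ (N : ℕ) (i0 iN ib : Fin N), 2 ≤ N → i0.val = 0 → iN.val = N - 1 →
    ib.val + 1 < N → ∀ t : ℝ, 0 < t →
    MemLp (fun p : Obs N => p.2.2.2.2) 2 (fluxLaw (pinnedChain ω₂ lam β γ) N i0 iN ib T T t (μ N T T)) ∧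
    variance (fun p : Obs N => p.2.2.2.2) (fluxLaw (pinnedChain ω₂ lam β γ) N i0 iN ib T T t (μ N T T)) =
      bondHeatVariance ω₂ lam β γ T N ib.val t

/-- **K6b — δ-continuity of the bond-heat variance.** Under weak-NESS uniqueness, along a steady-state
family at `T ± δ/2`, for `N ≥ 2`, a real bond `ib`, `t > 0`: the bond heat `Q_t` is square integrable
for small `δ ≠ 0` and `Var_δ(Q_t) → Var_0(Q_t)` as `δ → 0`, `δ ≠ 0`, the limit being the variance under
the equal-temperature member `μ N T T` (`μ_δ ⇒ μ_T`: tightness from the `e^{ϑH}`-moments of the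
Krylov–Bogoliubov measures — `pinnedChain_H2_of_pos` / `pinnedChain_lintegral_exp_hamiltonian_small` with
constants locally uniform in the temperatures —, closedness of the weak Fokker–Planck class under such
limits, uniqueness at `(T, T)`; continuity of the flow in the noise amplitudes `√(2γ(T ± δ/2))`,
`LangevinChainNoiseContinuity.pinnedChain_norm_chainFlow_sub_chainFlow_le`; uniform integrability of
`Q_t²` from `|j_b| ≤ C_ε e^{εH}` and (3.4) `lintegral_exp_mul_hamiltonian_pinnedChainSemigroup_le`).
Shared by every finite-`δ` line of this crux. -/
def BondHeatVarianceContinuity : Prop :=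
  ∀ ω₂ lam β γ : ℝ, 0 < ω₂ → 0 < lam → 0 < β → 0 < γ →
  (∀ (N : ℕ) (T_L T_R : ℝ), 0 < T_L → 0 < T_R → ∀ μ ν : Measure (PhaseSpace N),
    (pinnedChain ω₂ lam β γ).IsSteadyState N T_L T_R μ →
    (pinnedChain ω₂ lam β γ).IsSteadyState N T_L T_R ν → μ = ν) →
  ∀ μ : (N : ℕ) → ℝ → ℝ → Measure (PhaseSpace N),
    (∀ (N : ℕ) (T_L T_R : ℝ), 0 < T_L → 0 < T_R →
      (pinnedChain ω₂ lam β γ).IsSteadyState N T_L T_R (μ N T_L T_R)) →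
  ∀ T : ℝ, 0 < T → ∀ (N : ℕ) (i0 iN ib : Fin N), 2 ≤ N → i0.val = 0 → iN.val = N - 1 →
    ib.val + 1 < N → ∀ t : ℝ, 0 < t →
    (∀ᶠ δ in 𝓝[≠] (0 : ℝ), MemLp (fun p : Obs N => p.2.2.2.2) 2
      (fluxLaw (pinnedChain ω₂ lam β γ) N i0 iN ib (T + δ / 2) (T - δ / 2) t
        (μ N (T + δ / 2) (T - δ / 2)))) ∧
    Tendsto (fun δ : ℝ => variance (fun p : Obs N => p.2.2.2.2)
        (fluxLaw (pinnedChain ω₂ lam β γ) N i0 iN ib (T + δ / 2) (T - δ / 2) t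
          (μ N (T + δ / 2) (T - δ / 2)))) (𝓝[≠] 0)
      (𝓝 (variance (fun p : Obs N => p.2.2.2.2)
        (fluxLaw (pinnedChain ω₂ lam β γ) N i0 iN ib T T t (μ N T T))))

/-- **Finite-bias Clausius inequality, injected-power form** (clause (a) before the limit): under
weak-NESS uniqueness, in the weak steady state `μ` of the `N`-site chain (`N ≥ 2`) at `T_L, T_R > 0` the
mean work rate of the left thermostatted momentum has the sign of `T_L - T_R`:
`0 ≤ (T_L - T_R)·⟨p_0 ∂_{q_0}H⟩_μ` (`= (T_L - T_R)·J` by the fourth conjunct of `SteadyHeatRates`). The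
registered stub is the IMPLICATION from (GDB): against the Gibbs density `ρ_{T_R} ∝ e^{-H/T_R}` (a
`Θ`-invariant TRANSIENT start, positive everywhere) (GDB) gives
`d(Θ̃_*P^ν)/dP^ν = ρ_{T_R}(x_t)/ρ_{T_R}(x_0)·e^{Q_L/T_L+Q_R/T_R} = e^{-(Q_L+Q_R)/T_R}e^{Q_L/T_L+Q_R/T_R}`
(pathwise energy balance `H(x_t) - H(x_0) = Q_L + Q_R`, `LangevinChainEnergyIdentity.pinnedChain_hamiltonian_chainFlow_eq`,
two distinct bath sites since `N ≥ 2`), i.e. `Σ^ν_t = Q_L(1/T_R - 1/T_L)` with NO density term, so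
`0 ≤ KL(P^ν‖Θ̃_*P^ν) = (1/T_R - 1/T_L)·E_ν[Q_{L,t}]` for every `t ≥ 0`; then
`E_ν[Q_{L,t}] = E_ν[Δ(p_0²/2)] + ∫₀ᵗ (νP_s)(p_0∂_{q_0}H) ds` with `E_ν[p_0(t)²]` bounded in `t` ((3.4) + H2)
and `(1/t)∫₀ᵗ νP_s ds ⇒ μ` (Krylov–Bogoliubov–Cesàro, `Literature.Probability.Process.KrylovBogoliubovCesaro`:
tightness from uniform `e^{ϑH}`-moments, limit points invariant ⇒ weak steady states
`pinnedChain_isSteadyState_of_isInvariant` ⇒ `= μ` by (U); uniform integrability of `p_0∂_{q_0}H`), hence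
`0 ≤ (1/T_R - 1/T_L)·⟨p_0∂_{q_0}H⟩_μ`, i.e. the claim. -/
def FiniteBiasClausius : Prop :=
  ∀ ω₂ lam β γ : ℝ, 0 < ω₂ → 0 < lam → 0 < β → 0 < γ →
  (∀ (N : ℕ) (T_L T_R : ℝ), 0 < T_L → 0 < T_R → ∀ μ ν : Measure (PhaseSpace N),
    (pinnedChain ω₂ lam β γ).IsSteadyState N T_L T_R μ →
    (pinnedChain ω₂ lam β γ).IsSteadyState N T_L T_R ν → μ = ν) →
  ∀ (N : ℕ) (i0 : Fin N), 2 ≤ N → i0.val = 0 →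
  ∀ (T_L T_R : ℝ), 0 < T_L → 0 < T_R → ∀ μ : Measure (PhaseSpace N),
    (pinnedChain ω₂ lam β γ).IsSteadyState N T_L T_R μ →
    0 ≤ (T_L - T_R) * ∫ x, x.2 i0 * partialQ i0 ((pinnedChain ω₂ lam β γ).hamiltonian N) x ∂μ

/-! ## The lever composes as typed: K1 + K3 ⇒ (GDB) on the marginal -/

/-- **(GDB) from K1 and K3.** `Θ̃_* R = Θ_*(r_* R) = e^{2γt} Θ_* R̂` (K1), `Θ_* R̂ = ∫dy (law of Θ∘X̂
from Θy)` (Lebesgue is `Θ`-invariant, `measurePreserving_momentumReversal`) `= ∫dy e^{-2γt}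
e^{Σ_b Q_b/T_b} P_y` (K3). Kernel-checked here: the slot/sign bookkeeping of the typed K1, K3
(endpoint swap, `Θ`, the parities of `I_L, I_R, Q^b`) is exactly right. -/
theorem heatFluxDetailedBalance_of (h1 : PathLebesgueDuality) (h3 : AntiDampedGirsanov) :
    HeatFluxDetailedBalance := by
  intro ω₂ lam β γ hω hl hβ hγ N i0 iN ib hN hi0 hiN T_L T_R hTL hTR t ht F hF
  set P := pinnedChain ω₂ lam β γ with hP
  have hG : Measurable fun p : Obs N => F (flipObs N (swapObs N p)) :=
    hF.comp ((measurable_flipObs N).comp (measurable_swapObs N))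
  -- K1 applied to `F ∘ Θ̃ ∘ r` (note `r ∘ r = id` definitionally on `rawObs`)
  have step1 :
      ∫⁻ z, ∫⁻ w, F (flipObs N (rawObs P N i0 iN ib t z (fwdPath P N T_L T_R z w))) ∂wienerPair =
        ENNReal.ofReal (Real.exp (2 * γ * t)) *
          ∫⁻ y, ∫⁻ w, F (flipObs N (swapObs N
            (rawObs P N i0 iN ib t y (revPath P N T_L T_R y w)))) ∂wienerPair :=
    h1 ω₂ lam β γ hω hl hβ hγ N i0 iN ib hN hi0 hiN T_L T_R hTL hTR t ht _ hG
  -- K3 at the flipped starting point (note `Θ̃ ∘ r = r ∘ Θ̃` definitionally)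
  have step3 : ∀ y : PhaseSpace N,
      ENNReal.ofReal (Real.exp (2 * γ * t)) *
          ∫⁻ w, F (flipObs N (swapObs N (rawObs P N i0 iN ib t (momentumReversal N y)
            (revPath P N T_L T_R (momentumReversal N y) w)))) ∂wienerPair =
        ∫⁻ w, ENNReal.ofReal (Real.exp
            (leftHeat i0 (rawObs P N i0 iN ib t y (fwdPath P N T_L T_R y w)) / T_L +
              rightHeat iN (rawObs P N i0 iN ib t y (fwdPath P N T_L T_R y w)) / T_R)) *
          F (rawObs P N i0 iN ib t y (fwdPath P N T_L T_R y w)) ∂wienerPair :=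
    fun y => h3 ω₂ lam β γ hω hl hβ hγ N i0 iN ib hN hi0 hiN T_L T_R hTL hTR t ht.le y F hF
  rw [step1, ← lintegral_const_mul' _ _ ENNReal.ofReal_ne_top]
  -- substitute `y ↦ Θ y` in the outer Lebesgue integral, then K3 pointwise
  refine (MeasurePreserving.lintegral_map_equiv _ (momentumReversal N)
    (measurePreserving_momentumReversal N)).trans ?_
  exact lintegral_congr step3

/-! ## The `δ → 0` certificate (= Disproof.lean §7, re-proved so that the skeleton is self-contained) -/

/-- Carnot factor algebra: `1/(T - δ/2) - 1/(T + δ/2) = δ / (T² - δ²/4)`. -/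
theorem inv_sub_inv_temperatures {T δ : ℝ} (h₁ : T - δ / 2 ≠ 0) (h₂ : T + δ / 2 ≠ 0) :
    1 / (T - δ / 2) - 1 / (T + δ / 2) = δ / (T ^ 2 - δ ^ 2 / 4) := by
  have h3 : T ^ 2 - δ ^ 2 / 4 = (T - δ / 2) * (T + δ / 2) := by ring
  rw [h3, div_sub_div _ _ h₁ h₂]
  congr 1
  ring

/-- `exp x - 1 ≤ x · exp x`. -/
theorem exp_sub_one_le_mul_exp (x : ℝ) : Real.exp x - 1 ≤ x * Real.exp x := by
  have h := Real.add_one_le_exp (-x)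
  have hx := Real.exp_pos x
  have : Real.exp (-x) * Real.exp x = 1 := by rw [← Real.exp_add]; simp
  nlinarith

/-- **Bookkeeping certificate (Disproof §7 `fturShape_pointwise_of_hvv_family`).** At one bond and
one `t > 0`, with `m δ = ⟨Q_t⟩_δ`, `v δ = Var_δ(Q_t)`, `s δ = ⟨Σ_t⟩_δ` along `T ± δ/2`: HVV at each
`δ`, `v ≥ 0`, `m δ/δ → G t`, `v δ → V` and `s δ ≤ (m δ/t)(1/(T-δ/2) - 1/(T+δ/2)) t + K δ²` give
`2 G² t² ≤ V (G t/T² + K)`. -/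
theorem shape_of_hvv_family {m v s : ℝ → ℝ} {G T K V t : ℝ} (ht : 0 < t) (hT : 0 < T)
    (hHVV : ∀ᶠ δ in 𝓝[≠] (0 : ℝ), m δ ^ 2 ≤ 1 / 2 * v δ * (Real.exp (s δ) - 1))
    (hv0 : ∀ᶠ δ in 𝓝[≠] (0 : ℝ), 0 ≤ v δ)
    (hm : Tendsto (fun δ => m δ / δ) (𝓝[≠] 0) (𝓝 (G * t)))
    (hv : Tendsto v (𝓝[≠] 0) (𝓝 V))
    (hs : ∀ᶠ δ in 𝓝[≠] (0 : ℝ),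
      s δ ≤ m δ / t * (1 / (T - δ / 2) - 1 / (T + δ / 2)) * t + K * δ ^ 2) :
    2 * G ^ 2 * t ^ 2 ≤ V * (G * t / T ^ 2 + K) := by
  have _ := ht
  set w : ℝ → ℝ := fun δ => m δ / δ / (T ^ 2 - δ ^ 2 / 4) + K with hw_def
  have hI : ∀ᶠ δ in 𝓝[≠] (0 : ℝ), δ ∈ Set.Ioo (-T) T ∧ δ ≠ 0 := by
    have h1 : ∀ᶠ δ in 𝓝 (0 : ℝ), δ ∈ Set.Ioo (-T) T := Ioo_mem_nhds (by linarith) hT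
    have h1' : ∀ᶠ δ in 𝓝[≠] (0 : ℝ), δ ∈ Set.Ioo (-T) T := mem_nhdsWithin_of_mem_nhds h1
    have h2' : ∀ᶠ δ in 𝓝[≠] (0 : ℝ), δ ≠ 0 := self_mem_nhdsWithin
    exact h1'.and h2'
  have hden : Tendsto (fun δ : ℝ => T ^ 2 - δ ^ 2 / 4) (𝓝[≠] 0) (𝓝 (T ^ 2)) := by
    have : Tendsto (fun δ : ℝ => T ^ 2 - δ ^ 2 / 4) (𝓝 0) (𝓝 (T ^ 2 - 0 ^ 2 / 4)) :=
      ((continuous_const.sub ((continuous_pow 2).div_const 4)).tendsto 0)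
    simpa using this.mono_left nhdsWithin_le_nhds
  have hw : Tendsto w (𝓝[≠] 0) (𝓝 (G * t / T ^ 2 + K)) :=
    (hm.div hden (by positivity)).add tendsto_const_nhds
  have hsq : Tendsto (fun δ : ℝ => δ ^ 2) (𝓝[≠] 0) (𝓝 0) := by
    have : Tendsto (fun δ : ℝ => δ ^ 2) (𝓝 0) (𝓝 (0 ^ 2)) := (continuous_pow 2).tendsto 0
    simpa using this.mono_left nhdsWithin_le_nhds
  have hx : Tendsto (fun δ : ℝ => δ ^ 2 * w δ) (𝓝[≠] 0) (𝓝 0) := by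
    simpa using hsq.mul hw
  have hexp : Tendsto (fun δ : ℝ => Real.exp (δ ^ 2 * w δ)) (𝓝[≠] 0) (𝓝 1) := by
    have := (Real.continuous_exp.tendsto 0).comp hx
    simpa [Function.comp_def] using this
  have hs' : ∀ᶠ δ in 𝓝[≠] (0 : ℝ), s δ ≤ δ ^ 2 * w δ := by
    filter_upwards [hs, hI] with δ hδ hδI
    obtain ⟨⟨hlo, hhi⟩, hne⟩ := hδI
    have h₁ : T - δ / 2 ≠ 0 := by intro h; linarith
    have h₂ : T + δ / 2 ≠ 0 := by intro h; linarith
    have h₃ : T ^ 2 - δ ^ 2 / 4 ≠ 0 := by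
      have : T ^ 2 - δ ^ 2 / 4 = (T - δ / 2) * (T + δ / 2) := by ring
      rw [this]; exact mul_ne_zero h₁ h₂
    have e : m δ / t * (1 / (T - δ / 2) - 1 / (T + δ / 2)) * t + K * δ ^ 2 = δ ^ 2 * w δ := by
      rw [inv_sub_inv_temperatures h₁ h₂, hw_def]
      field_simp
    linarith [hδ, e.le, e.ge]
  have hev : ∀ᶠ δ in 𝓝[≠] (0 : ℝ),
      (m δ / δ) ^ 2 ≤ 1 / 2 * v δ * (w δ * Real.exp (δ ^ 2 * w δ)) := by
    filter_upwards [hHVV, hv0, hs', hI] with δ h1 h2 h3 hδI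
    obtain ⟨-, hne⟩ := hδI
    have hδ2 : 0 < δ ^ 2 := by positivity
    have h4 : Real.exp (s δ) - 1 ≤ Real.exp (δ ^ 2 * w δ) - 1 := by
      linarith [Real.exp_le_exp.mpr h3]
    have h5 : Real.exp (δ ^ 2 * w δ) - 1 ≤ δ ^ 2 * w δ * Real.exp (δ ^ 2 * w δ) :=
      exp_sub_one_le_mul_exp _
    have h6 : m δ ^ 2 ≤ 1 / 2 * v δ * (δ ^ 2 * w δ * Real.exp (δ ^ 2 * w δ)) := by
      have := mul_le_mul_of_nonneg_left (h4.trans h5) (by positivity : (0 : ℝ) ≤ 1 / 2 * v δ)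
      exact h1.trans this
    rw [div_pow, div_le_iff₀ hδ2]
    calc m δ ^ 2 ≤ 1 / 2 * v δ * (δ ^ 2 * w δ * Real.exp (δ ^ 2 * w δ)) := h6
      _ = 1 / 2 * v δ * (w δ * Real.exp (δ ^ 2 * w δ)) * δ ^ 2 := by ring
  have hL : Tendsto (fun δ => (m δ / δ) ^ 2) (𝓝[≠] 0) (𝓝 ((G * t) ^ 2)) := hm.pow 2
  have hR : Tendsto (fun δ => 1 / 2 * v δ * (w δ * Real.exp (δ ^ 2 * w δ))) (𝓝[≠] 0)
      (𝓝 (1 / 2 * V * ((G * t / T ^ 2 + K) * 1))) :=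
    (tendsto_const_nhds.mul hv).mul (hw.mul hexp)
  have key : (G * t) ^ 2 ≤ 1 / 2 * V * ((G * t / T ^ 2 + K) * 1) :=
    le_of_tendsto_of_tendsto hL hR hev
  nlinarith [key]

/-- Near `δ = 0` both bath temperatures `T ± δ/2` are positive. -/
theorem eventually_temperatures_pos {T : ℝ} (hT : 0 < T) :
    ∀ᶠ δ in 𝓝[≠] (0 : ℝ), 0 < T + δ / 2 ∧ 0 < T - δ / 2 := by
  have h1 : ∀ᶠ δ in 𝓝 (0 : ℝ), δ < 2 * T := eventually_lt_nhds (by linarith)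
  have h2 : ∀ᶠ δ in 𝓝 (0 : ℝ), -(2 * T) < δ := eventually_gt_nhds (by linarith)
  refine mem_nhdsWithin_of_mem_nhds ?_
  filter_upwards [h1, h2] with δ ha hb
  exact ⟨by linarith, by linarith⟩

/-! ## Transfer and composition -/

/-- The TRANSFER statement `C⁺ ⇒ ★` of the line (an implication, packaged as one `Prop` so that the
only theorem of this file whose conclusion is headed by the crux name is `LinearResponseFTUR_of`). -/
def TransferStatement : Prop :=
  HeatFluxDetailedBalance → (HeatFluxDetailedBalance → StationaryEntropyBalance) → SteadyHeatRates →
    EquilibriumBondHeatVariance → BondHeatVarianceContinuity →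
    (HeatFluxDetailedBalance → FiniteBiasClausius) →
    Summit.AtomisticToContinuum.FouriersLaw.Theses.BondHeatUncertainty.LinearResponseFTUR

/-- The COMPOSITION statement of the line: the seven stub statements imply the crux. -/
def LineComposition : Prop :=
  PathLebesgueDuality → AntiDampedGirsanov → (HeatFluxDetailedBalance → StationaryEntropyBalance) →
    SteadyHeatRates → EquilibriumBondHeatVariance → BondHeatVarianceContinuity →
    (HeatFluxDetailedBalance → FiniteBiasClausius) →
    Summit.AtomisticToContinuum.FouriersLaw.Theses.BondHeatUncertainty.LinearResponseFTUR

/-- **TRANSFER `C⁺ ⇒ ★` (PROVED).** The heat-flux detailed balance, the entropy balance it yields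
(K4), the steady heat rates, the equilibrium variance identity (K6a), the δ-continuity of the
bond-heat variance (K6b) and the finite-bias Clausius inequality (from (GDB)) imply the crux: at each
small `δ ≠ 0` instantiate the vendored (PROVED) Hasegawa–Van Vu FTUR on `Obs N` with
`P := fluxLaw … μ_δ`, `ι := flipObs`, `φ := Q^b` (exactly odd), and let `δ → 0` through
`shape_of_hvv_family`; (a) from Clausius (injected-power form) + the fourth conjunct of the rates by
`ge_of_tendsto`. -/
theorem transfer : TransferStatement := by
  intro hGDB h4 hR hV0 hV hC
  have hEB : StationaryEntropyBalance := h4 hGDB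
  have hCl : FiniteBiasClausius := hC hGDB
  intro ω₂ lam β γ hω hl hβ hγ huniq μ hμ T hT D hD P C V N hN
  have h2T := eventually_temperatures_pos hT
  have hN1 : (0 : ℝ) < (N : ℝ) - 1 := by
    have : (2 : ℝ) ≤ (N : ℝ) := by exact_mod_cast hN
    linarith
  let i0 : Fin N := ⟨0, by omega⟩
  let iN : Fin N := ⟨N - 1, by omega⟩
  have hi0 : i0.val = 0 := rfl
  have hiN : iN.val = N - 1 := rfl
  refine ⟨?_, ?_⟩
  · -- (a): the finite-bias second law `δ · J_δ ≥ 0` in injected-power form, then `δ → 0`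
    refine ge_of_tendsto (hD N) ?_
    filter_upwards [h2T, self_mem_nhdsWithin] with δ hδ hne
    have hne' : δ ≠ 0 := hne
    -- Clausius: `0 ≤ (T_L - T_R) ⟨p_0 ∂_{q_0}H⟩`
    have h0 := hCl ω₂ lam β γ hω hl hβ hγ huniq N i0 hN hi0 (T + δ / 2) (T - δ / 2) hδ.1 hδ.2
      (μ N (T + δ / 2) (T - δ / 2)) (hμ N _ _ hδ.1 hδ.2)
    -- rates, fourth conjunct (bond `0`, `t = 0`): `⟨p_0 ∂_{q_0}H⟩ = J = totalCurrent/(N-1)`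
    obtain ⟨-, -, -, hW⟩ := hR ω₂ lam β γ hω hl hβ hγ huniq N i0 iN i0 hN hi0 hiN
      (by show 0 + 1 < N; omega) (T + δ / 2) (T - δ / 2) hδ.1 hδ.2
      (μ N (T + δ / 2) (T - δ / 2)) (hμ N _ _ hδ.1 hδ.2) 0 le_rfl
    have e : T + δ / 2 - (T - δ / 2) = δ := by ring
    rw [e, hW] at h0
    -- `0 ≤ δ · (totalCurrent / (N-1))` ⇒ `0 ≤ totalCurrent / δ`
    show 0 ≤ (pinnedChain ω₂ lam β γ).totalCurrent (μ N (T + δ / 2) (T - δ / 2)) / δ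
    set J := (pinnedChain ω₂ lam β γ).totalCurrent (μ N (T + δ / 2) (T - δ / 2)) with hJ
    have h1 : 0 ≤ δ * J := by
      have := mul_nonneg h0 hN1.le
      have e2 : δ * (J / ((N : ℝ) - 1)) * ((N : ℝ) - 1) = δ * J := by
        field_simp
      linarith [e2.symm.le, e2.le]
    have e3 : J / δ = δ * J / δ ^ 2 := (div_eq_div_iff hne' (pow_ne_zero 2 hne')).2 (by ring)
    rw [e3]
    exact div_nonneg h1 (sq_nonneg δ)
  · -- (b): HVV at each small `δ`, then the bookkeeping certificate
    intro b hb t ht K hK hKL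
    let ib : Fin N := ⟨b, by omega⟩
    have hib : ib.val + 1 < N := hb
    let μδ : ℝ → Measure (PhaseSpace N) := fun δ => μ N (T + δ / 2) (T - δ / 2)
    let Pf : ℝ → Measure (Obs N) := fun δ =>
      fluxLaw (pinnedChain ω₂ lam β γ) N i0 iN ib (T + δ / 2) (T - δ / 2) t (μδ δ)
    let φ : Obs N → ℝ := fun p => p.2.2.2.2
    let J : ℝ → ℝ := fun δ => (pinnedChain ω₂ lam β γ).totalCurrent (μδ δ) / ((N : ℝ) - 1)
    let m : ℝ → ℝ := fun δ => t * J δ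
    let v : ℝ → ℝ := fun δ => variance φ (Pf δ)
    let s : ℝ → ℝ := fun δ => ∫ p, llr (Pf δ) ((Pf δ).map (flipObs N)) p ∂(Pf δ)
    have hKLfin : ∀ᶠ δ in 𝓝[≠] (0 : ℝ), InformationTheory.klDiv (μδ δ)
        (Measure.map (fun x : PhaseSpace N => (x.1, -x.2)) (μδ δ)) ≠ ⊤ := by
      filter_upwards [hKL] with δ hδ
      exact ne_top_of_le_ne_top ENNReal.ofReal_ne_top hδ
    obtain ⟨hMem, hvlim⟩ := hV ω₂ lam β γ hω hl hβ hγ huniq μ hμ T hT N i0 iN ib hN hi0 hiN hib t ht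
    obtain ⟨-, hV0eq⟩ := hV0 ω₂ lam β γ hω hl hβ hγ huniq μ hμ T hT N i0 iN ib hN hi0 hiN hib t ht
    have hvlim' : Tendsto v (𝓝[≠] 0) (𝓝 (bondHeatVariance ω₂ lam β γ T N b t)) := by
      have e : bondHeatVariance ω₂ lam β γ T N b t = variance (fun p : Obs N => p.2.2.2.2)
          (fluxLaw (pinnedChain ω₂ lam β γ) N i0 iN ib T T t (μ N T T)) := hV0eq.symm
      rw [e]
      exact hvlim
    have key : 2 * (D N / ((N : ℝ) - 1)) ^ 2 * t ^ 2 ≤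
        bondHeatVariance ω₂ lam β γ T N b t * (D N / ((N : ℝ) - 1) * t / T ^ 2 + K) := by
      refine shape_of_hvv_family (m := m) (v := v) (s := s) ht hT ?_ ?_ ?_ hvlim' ?_
      · -- the Hasegawa–Van Vu inequality at each small `δ`
        filter_upwards [h2T, hKLfin, hMem] with δ hδ hfin hmem
        obtain ⟨hprob, hac1, hac2, hllr, -, -, -⟩ :=
          hEB ω₂ lam β γ hω hl hβ hγ huniq N i0 iN ib hN hi0 hiN (T + δ / 2) (T - δ / 2) hδ.1 hδ.2
            (μδ δ) (hμ N _ _ hδ.1 hδ.2) hfin t ht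
        obtain ⟨-, -, hQb, -⟩ :=
          hR ω₂ lam β γ hω hl hβ hγ huniq N i0 iN ib hN hi0 hiN hib (T + δ / 2) (T - δ / 2) hδ.1 hδ.2
            (μδ δ) (hμ N _ _ hδ.1 hδ.2) t ht.le
        haveI : IsProbabilityMeasure (Pf δ) := hprob
        have hftur := Literature.Probability.Entropy.HasegawaVanVu2019_FTUR_holds (Obs N) (Pf δ)
          (flipObs N) (measurable_flipObs N) (flipObs_involutive N) hac1 hac2 hllr φ hmem
          (fun p => rfl)
        have hmean : ∫ p, φ p ∂(Pf δ) = m δ := hQb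
        rw [hmean] at hftur
        exact hftur
      · exact Eventually.of_forall fun δ => variance_nonneg _ _
      · -- `m δ / δ → G t`
        have hlim := ((hD N).const_mul t).div_const ((N : ℝ) - 1)
        have e1 : (fun δ => m δ / δ) = fun δ =>
            t * ((pinnedChain ω₂ lam β γ).totalCurrent (μ N (T + δ / 2) (T - δ / 2)) / δ) /
              ((N : ℝ) - 1) := by
          funext δ
          simp only [m, J, μδ]
          ring
        have e2 : D N / ((N : ℝ) - 1) * t = t * D N / ((N : ℝ) - 1) := by ring
        rw [e1, e2]
        exact hlim
      · -- the entropy balance: `⟨Σ_t⟩_δ = KL(μ_δ‖Θμ_δ) + t J_δ (1/T_R - 1/T_L) ≤ K δ² + …`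
        filter_upwards [h2T, hKLfin, hKL] with δ hδ hfin hKδ
        obtain ⟨-, -, -, -, -, -, hllr_eq⟩ :=
          hEB ω₂ lam β γ hω hl hβ hγ huniq N i0 iN ib hN hi0 hiN (T + δ / 2) (T - δ / 2) hδ.1 hδ.2
            (μδ δ) (hμ N _ _ hδ.1 hδ.2) hfin t ht
        obtain ⟨hQL, hQR, -, -⟩ :=
          hR ω₂ lam β γ hω hl hβ hγ huniq N i0 iN ib hN hi0 hiN hib (T + δ / 2) (T - δ / 2) hδ.1 hδ.2
            (μδ δ) (hμ N _ _ hδ.1 hδ.2) t ht.le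
        have hKL' : (InformationTheory.klDiv (μδ δ)
            (Measure.map (fun x : PhaseSpace N => (x.1, -x.2)) (μδ δ))).toReal ≤ K * δ ^ 2 :=
          ENNReal.toReal_le_of_le_ofReal (by positivity) hKδ
        have hs_val : s δ = (InformationTheory.klDiv (μδ δ)
            (Measure.map (fun x : PhaseSpace N => (x.1, -x.2)) (μδ δ))).toReal -
              t * J δ / (T + δ / 2) - -(t * J δ) / (T - δ / 2) := by
          show ∫ p, llr (Pf δ) ((Pf δ).map (flipObs N)) p ∂(Pf δ) = _
          rw [hllr_eq, hQL, hQR]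
        have e3 : m δ / t * (1 / (T - δ / 2) - 1 / (T + δ / 2)) * t =
            t * J δ * (1 / (T - δ / 2) - 1 / (T + δ / 2)) := by
          show t * J δ / t * (1 / (T - δ / 2) - 1 / (T + δ / 2)) * t = _
          field_simp
        have e4 : (InformationTheory.klDiv (μδ δ)
            (Measure.map (fun x : PhaseSpace N => (x.1, -x.2)) (μδ δ))).toReal -
              t * J δ / (T + δ / 2) - -(t * J δ) / (T - δ / 2) =
            (InformationTheory.klDiv (μδ δ)
              (Measure.map (fun x : PhaseSpace N => (x.1, -x.2)) (μδ δ))).toReal +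
              t * J δ * (1 / (T - δ / 2) - 1 / (T + δ / 2)) := by
          ring
        rw [hs_val, e3, e4]
        linarith [hKL']
    exact key

/-- **COMPOSITION (PROVED, no `sorry`, axioms `propext`/`Classical.choice`/`Quot.sound`).** The seven
stub statements imply the crux: `transfer ∘ heatFluxDetailedBalance_of`. -/
theorem lineComposition : LineComposition := fun h1 h3 h4 hR hV0 hV hC =>
  transfer (heatFluxDetailedBalance_of h1 h3) h4 hR hV0 hV hC

/-! ## Registered stubs

Each `stub_*` is stated with its statement EXPANDED (the text registered on the ledger and landed
verbatim by the stub files, which import the vocabulary from `Theorems/BondHeatUncertaintyDefs.lean`);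
its type is definitionally the corresponding `def … : Prop` above, so `lineComposition` applies to the
seven theorems as they are. -/

theorem stub_pathLebesgueDuality :
  ∀ ω₂ lam β γ : ℝ, 0 < ω₂ → 0 < lam → 0 < β → 0 < γ →
  ∀ (N : ℕ) (i0 iN ib : Fin N), 2 ≤ N → i0.val = 0 → iN.val = N - 1 →
  ∀ (T_L T_R : ℝ), 0 < T_L → 0 < T_R → ∀ t : ℝ, 0 < t →
  ∀ G : Obs N → ℝ≥0∞, Measurable G →
    ∫⁻ z, ∫⁻ w, G (swapObs N (rawObs (pinnedChain ω₂ lam β γ) N i0 iN ib t z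
        (fwdPath (pinnedChain ω₂ lam β γ) N T_L T_R z w))) ∂wienerPair =
      ENNReal.ofReal (Real.exp (2 * γ * t)) *
        ∫⁻ y, ∫⁻ w, G (rawObs (pinnedChain ω₂ lam β γ) N i0 iN ib t y
          (revPath (pinnedChain ω₂ lam β γ) N T_L T_R y w)) ∂wienerPair := by
  sorry

theorem stub_antiDampedGirsanov :
  ∀ ω₂ lam β γ : ℝ, 0 < ω₂ → 0 < lam → 0 < β → 0 < γ →
  ∀ (N : ℕ) (i0 iN ib : Fin N), 2 ≤ N → i0.val = 0 → iN.val = N - 1 →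
  ∀ (T_L T_R : ℝ), 0 < T_L → 0 < T_R → ∀ t : ℝ, 0 ≤ t →
  ∀ (y : PhaseSpace N) (F : Obs N → ℝ≥0∞), Measurable F →
    ENNReal.ofReal (Real.exp (2 * γ * t)) *
        ∫⁻ w, F (swapObs N (flipObs N (rawObs (pinnedChain ω₂ lam β γ) N i0 iN ib t (y.1, -y.2)
          (revPath (pinnedChain ω₂ lam β γ) N T_L T_R (y.1, -y.2) w)))) ∂wienerPair =
      ∫⁻ w, ENNReal.ofReal (Real.exp
          (leftHeat i0 (rawObs (pinnedChain ω₂ lam β γ) N i0 iN ib t y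
              (fwdPath (pinnedChain ω₂ lam β γ) N T_L T_R y w)) / T_L +
            rightHeat iN (rawObs (pinnedChain ω₂ lam β γ) N i0 iN ib t y
              (fwdPath (pinnedChain ω₂ lam β γ) N T_L T_R y w)) / T_R)) *
        F (rawObs (pinnedChain ω₂ lam β γ) N i0 iN ib t y
          (fwdPath (pinnedChain ω₂ lam β γ) N T_L T_R y w)) ∂wienerPair := by
  sorry

theorem stub_entropyBalance :
    (∀ ω₂ lam β γ : ℝ, 0 < ω₂ → 0 < lam → 0 < β → 0 < γ →
  ∀ (N : ℕ) (i0 iN ib : Fin N), 2 ≤ N → i0.val = 0 → iN.val = N - 1 →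
  ∀ (T_L T_R : ℝ), 0 < T_L → 0 < T_R → ∀ t : ℝ, 0 < t →
  ∀ F : Obs N → ℝ≥0∞, Measurable F →
    ∫⁻ z, ∫⁻ w, F (flipObs N (rawObs (pinnedChain ω₂ lam β γ) N i0 iN ib t z
        (fwdPath (pinnedChain ω₂ lam β γ) N T_L T_R z w))) ∂wienerPair =
      ∫⁻ z, ∫⁻ w, ENNReal.ofReal (Real.exp
          (leftHeat i0 (rawObs (pinnedChain ω₂ lam β γ) N i0 iN ib t z
              (fwdPath (pinnedChain ω₂ lam β γ) N T_L T_R z w)) / T_L +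
            rightHeat iN (rawObs (pinnedChain ω₂ lam β γ) N i0 iN ib t z
              (fwdPath (pinnedChain ω₂ lam β γ) N T_L T_R z w)) / T_R)) *
        F (rawObs (pinnedChain ω₂ lam β γ) N i0 iN ib t z
          (fwdPath (pinnedChain ω₂ lam β γ) N T_L T_R z w)) ∂wienerPair) →
  ∀ ω₂ lam β γ : ℝ, 0 < ω₂ → 0 < lam → 0 < β → 0 < γ →
  (∀ (N : ℕ) (T_L T_R : ℝ), 0 < T_L → 0 < T_R → ∀ μ ν : Measure (PhaseSpace N),
    (pinnedChain ω₂ lam β γ).IsSteadyState N T_L T_R μ →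
    (pinnedChain ω₂ lam β γ).IsSteadyState N T_L T_R ν → μ = ν) →
  ∀ (N : ℕ) (i0 iN ib : Fin N), 2 ≤ N → i0.val = 0 → iN.val = N - 1 →
  ∀ (T_L T_R : ℝ), 0 < T_L → 0 < T_R → ∀ μ : Measure (PhaseSpace N),
    (pinnedChain ω₂ lam β γ).IsSteadyState N T_L T_R μ →
    InformationTheory.klDiv μ (Measure.map (fun x : PhaseSpace N => (x.1, -x.2)) μ) ≠ ⊤ →
  ∀ t : ℝ, 0 < t →
    IsProbabilityMeasure (fluxLaw (pinnedChain ω₂ lam β γ) N i0 iN ib T_L T_R t μ) ∧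
    fluxLaw (pinnedChain ω₂ lam β γ) N i0 iN ib T_L T_R t μ ≪
      (fluxLaw (pinnedChain ω₂ lam β γ) N i0 iN ib T_L T_R t μ).map (flipObs N) ∧
    (fluxLaw (pinnedChain ω₂ lam β γ) N i0 iN ib T_L T_R t μ).map (flipObs N) ≪
      fluxLaw (pinnedChain ω₂ lam β γ) N i0 iN ib T_L T_R t μ ∧
    Integrable (llr (fluxLaw (pinnedChain ω₂ lam β γ) N i0 iN ib T_L T_R t μ)
      ((fluxLaw (pinnedChain ω₂ lam β γ) N i0 iN ib T_L T_R t μ).map (flipObs N)))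
      (fluxLaw (pinnedChain ω₂ lam β γ) N i0 iN ib T_L T_R t μ) ∧
    Integrable (leftHeat i0) (fluxLaw (pinnedChain ω₂ lam β γ) N i0 iN ib T_L T_R t μ) ∧
    Integrable (rightHeat iN) (fluxLaw (pinnedChain ω₂ lam β γ) N i0 iN ib T_L T_R t μ) ∧
    ∫ p, llr (fluxLaw (pinnedChain ω₂ lam β γ) N i0 iN ib T_L T_R t μ)
        ((fluxLaw (pinnedChain ω₂ lam β γ) N i0 iN ib T_L T_R t μ).map (flipObs N)) p
        ∂(fluxLaw (pinnedChain ω₂ lam β γ) N i0 iN ib T_L T_R t μ) =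
      (InformationTheory.klDiv μ (Measure.map (fun x : PhaseSpace N => (x.1, -x.2)) μ)).toReal -
        (∫ p, leftHeat i0 p ∂(fluxLaw (pinnedChain ω₂ lam β γ) N i0 iN ib T_L T_R t μ)) / T_L -
        (∫ p, rightHeat iN p ∂(fluxLaw (pinnedChain ω₂ lam β γ) N i0 iN ib T_L T_R t μ)) / T_R := by
  sorry

theorem stub_steadyHeatRates :
  ∀ ω₂ lam β γ : ℝ, 0 < ω₂ → 0 < lam → 0 < β → 0 < γ →
  (∀ (N : ℕ) (T_L T_R : ℝ), 0 < T_L → 0 < T_R → ∀ μ ν : Measure (PhaseSpace N),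
    (pinnedChain ω₂ lam β γ).IsSteadyState N T_L T_R μ →
    (pinnedChain ω₂ lam β γ).IsSteadyState N T_L T_R ν → μ = ν) →
  ∀ (N : ℕ) (i0 iN ib : Fin N), 2 ≤ N → i0.val = 0 → iN.val = N - 1 → ib.val + 1 < N →
  ∀ (T_L T_R : ℝ), 0 < T_L → 0 < T_R → ∀ μ : Measure (PhaseSpace N),
    (pinnedChain ω₂ lam β γ).IsSteadyState N T_L T_R μ →
  ∀ t : ℝ, 0 ≤ t →
    ∫ p, leftHeat i0 p ∂(fluxLaw (pinnedChain ω₂ lam β γ) N i0 iN ib T_L T_R t μ) =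
      t * ((pinnedChain ω₂ lam β γ).totalCurrent μ / ((N : ℝ) - 1)) ∧
    ∫ p, rightHeat iN p ∂(fluxLaw (pinnedChain ω₂ lam β γ) N i0 iN ib T_L T_R t μ) =
      -(t * ((pinnedChain ω₂ lam β γ).totalCurrent μ / ((N : ℝ) - 1))) ∧
    ∫ p, p.2.2.2.2 ∂(fluxLaw (pinnedChain ω₂ lam β γ) N i0 iN ib T_L T_R t μ) =
      t * ((pinnedChain ω₂ lam β γ).totalCurrent μ / ((N : ℝ) - 1)) ∧
    ∫ x, x.2 i0 * partialQ i0 ((pinnedChain ω₂ lam β γ).hamiltonian N) x ∂μ =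
      (pinnedChain ω₂ lam β γ).totalCurrent μ / ((N : ℝ) - 1) := by
  sorry

theorem stub_equilibriumBondHeatVariance :
  ∀ ω₂ lam β γ : ℝ, 0 < ω₂ → 0 < lam → 0 < β → 0 < γ →
  (∀ (N : ℕ) (T_L T_R : ℝ), 0 < T_L → 0 < T_R → ∀ μ ν : Measure (PhaseSpace N),
    (pinnedChain ω₂ lam β γ).IsSteadyState N T_L T_R μ →
    (pinnedChain ω₂ lam β γ).IsSteadyState N T_L T_R ν → μ = ν) →
  ∀ μ : (N : ℕ) → ℝ → ℝ → Measure (PhaseSpace N),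
    (∀ (N : ℕ) (T_L T_R : ℝ), 0 < T_L → 0 < T_R →
      (pinnedChain ω₂ lam β γ).IsSteadyState N T_L T_R (μ N T_L T_R)) →
  ∀ T : ℝ, 0 < T → ∀ (N : ℕ) (i0 iN ib : Fin N), 2 ≤ N → i0.val = 0 → iN.val = N - 1 →
    ib.val + 1 < N → ∀ t : ℝ, 0 < t →
    MemLp (fun p : Obs N => p.2.2.2.2) 2 (fluxLaw (pinnedChain ω₂ lam β γ) N i0 iN ib T T t (μ N T T)) ∧
    variance (fun p : Obs N => p.2.2.2.2) (fluxLaw (pinnedChain ω₂ lam β γ) N i0 iN ib T T t (μ N T T)) =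
      bondHeatVariance ω₂ lam β γ T N ib.val t := by
  sorry

theorem stub_bondHeatVarianceContinuity :
  ∀ ω₂ lam β γ : ℝ, 0 < ω₂ → 0 < lam → 0 < β → 0 < γ →
  (∀ (N : ℕ) (T_L T_R : ℝ), 0 < T_L → 0 < T_R → ∀ μ ν : Measure (PhaseSpace N),
    (pinnedChain ω₂ lam β γ).IsSteadyState N T_L T_R μ →
    (pinnedChain ω₂ lam β γ).IsSteadyState N T_L T_R ν → μ = ν) →
  ∀ μ : (N : ℕ) → ℝ → ℝ → Measure (PhaseSpace N),
    (∀ (N : ℕ) (T_L T_R : ℝ), 0 < T_L → 0 < T_R →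
      (pinnedChain ω₂ lam β γ).IsSteadyState N T_L T_R (μ N T_L T_R)) →
  ∀ T : ℝ, 0 < T → ∀ (N : ℕ) (i0 iN ib : Fin N), 2 ≤ N → i0.val = 0 → iN.val = N - 1 →
    ib.val + 1 < N → ∀ t : ℝ, 0 < t →
    (∀ᶠ δ in 𝓝[≠] (0 : ℝ), MemLp (fun p : Obs N => p.2.2.2.2) 2
      (fluxLaw (pinnedChain ω₂ lam β γ) N i0 iN ib (T + δ / 2) (T - δ / 2) t
        (μ N (T + δ / 2) (T - δ / 2)))) ∧
    Tendsto (fun δ : ℝ => variance (fun p : Obs N => p.2.2.2.2)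
        (fluxLaw (pinnedChain ω₂ lam β γ) N i0 iN ib (T + δ / 2) (T - δ / 2) t
          (μ N (T + δ / 2) (T - δ / 2)))) (𝓝[≠] 0)
      (𝓝 (variance (fun p : Obs N => p.2.2.2.2)
        (fluxLaw (pinnedChain ω₂ lam β γ) N i0 iN ib T T t (μ N T T)))) := by
  sorry

theorem stub_finiteBiasClausius :
    (∀ ω₂ lam β γ : ℝ, 0 < ω₂ → 0 < lam → 0 < β → 0 < γ →
  ∀ (N : ℕ) (i0 iN ib : Fin N), 2 ≤ N → i0.val = 0 → iN.val = N - 1 →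
  ∀ (T_L T_R : ℝ), 0 < T_L → 0 < T_R → ∀ t : ℝ, 0 < t →
  ∀ F : Obs N → ℝ≥0∞, Measurable F →
    ∫⁻ z, ∫⁻ w, F (flipObs N (rawObs (pinnedChain ω₂ lam β γ) N i0 iN ib t z
        (fwdPath (pinnedChain ω₂ lam β γ) N T_L T_R z w))) ∂wienerPair =
      ∫⁻ z, ∫⁻ w, ENNReal.ofReal (Real.exp
          (leftHeat i0 (rawObs (pinnedChain ω₂ lam β γ) N i0 iN ib t z
              (fwdPath (pinnedChain ω₂ lam β γ) N T_L T_R z w)) / T_L +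
            rightHeat iN (rawObs (pinnedChain ω₂ lam β γ) N i0 iN ib t z
              (fwdPath (pinnedChain ω₂ lam β γ) N T_L T_R z w)) / T_R)) *
        F (rawObs (pinnedChain ω₂ lam β γ) N i0 iN ib t z
          (fwdPath (pinnedChain ω₂ lam β γ) N T_L T_R z w)) ∂wienerPair) →
  ∀ ω₂ lam β γ : ℝ, 0 < ω₂ → 0 < lam → 0 < β → 0 < γ →
  (∀ (N : ℕ) (T_L T_R : ℝ), 0 < T_L → 0 < T_R → ∀ μ ν : Measure (PhaseSpace N),
    (pinnedChain ω₂ lam β γ).IsSteadyState N T_L T_R μ →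
    (pinnedChain ω₂ lam β γ).IsSteadyState N T_L T_R ν → μ = ν) →
  ∀ (N : ℕ) (i0 : Fin N), 2 ≤ N → i0.val = 0 →
  ∀ (T_L T_R : ℝ), 0 < T_L → 0 < T_R → ∀ μ : Measure (PhaseSpace N),
    (pinnedChain ω₂ lam β γ).IsSteadyState N T_L T_R μ →
    0 ≤ (T_L - T_R) * ∫ x, x.2 i0 * partialQ i0 ((pinnedChain ω₂ lam β γ).hamiltonian N) x ∂μ := by
  sorry

/-- **`LinearResponseFTUR_of` — the crux BY NAME from the seven registered stubs** (the composition
`lineComposition`, itself sorry-free, applied to `stub_pathLebesgueDuality`, `stub_antiDampedGirsanov`,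
`stub_entropyBalance`, `stub_steadyHeatRates`, `stub_equilibriumBondHeatVariance`,
`stub_bondHeatVarianceContinuity`, `stub_finiteBiasClausius`; every `sorry` of this file sits inside
those seven stubs). -/
theorem LinearResponseFTUR_of :
    Summit.AtomisticToContinuum.FouriersLaw.Theses.BondHeatUncertainty.LinearResponseFTUR :=
  lineComposition stub_pathLebesgueDuality stub_antiDampedGirsanov stub_entropyBalance
    stub_steadyHeatRates stub_equilibriumBondHeatVariance stub_bondHeatVarianceContinuity
    stub_finiteBiasClausius

end Summit.AtomisticToContinuum.FouriersLaw.Cruxes.LinearResponseFTUR.LebesgueFlipDuality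

end
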